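import Literature.MathematicalPhysics.QuantumLattice.GrassmannGaussianChargeRule
import Literature.MathematicalPhysics.QuantumLattice.GrassmannParity
import Mathlib.Analysis.Normed.Field.Basic
import HarnessLib

/-!
# Wick's rule for four-block words `(ψ̄_{i_A} ψ_{j_A})(ψ̄_{i_B} ψ_{j_B})`

Trunk **QLatticeAQFT**; companion of `GrassmannGaussianMoments.lean` (Wick rule in determinant
form for pair-ordered and block-ordered monomials) and `GrassmannGaussianChargeRule.lean`
(`#ψ̄ ≠ #ψ ⇒ 0`).  When two local observables, each expanded in the monomial basis of its own
Grassmann algebra `Λ(κ ⊕ₗ κ)` (every monomial is a two-block word `ψ̄_i ψ_j`, see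
`GrassmannMonomialCoefficients.lean`) and placed in a common algebra `Λ(ι ⊕ₗ ι)` by a
relabelling of generators, are multiplied, the words to be integrated against the Gaussian weight
are *four-block words* `(ψ̄_{i_A} ψ_{j_A})(ψ̄_{i_B} ψ_{j_B})`.  Everything is a `theorem`.

## Main results (namespace `Literature.MathematicalPhysics.QuantumLattice`)

* `GrassmannAlgebra.prod_map_gen_mul_prod_map_gen` — two ordered products of `m` and `n`
  generators commute up to `(-1)^{mn}`; `prod_psi_mul_prod_psiBar`; `fourBlock_eq_smul_block` —
  the four-block word is `(-1)^{l₁ k₂}` times the block word `ψ̄_{i_A ++ i_B} ψ_{j_A ++ j_B}`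
  (`Fin.append`; `comp_fin_append`);
* `berezin_grassmannExp_quadratic_mul_fourBlock` — **Wick rule for four-block words**
  (`IsUnit (det A)`, `#ψ̄ = #ψ = k`):
  `∫ e^{ψ̄Aψ} W = (-1)^{n(n-1)/2 + k(k-1)/2 + l₁k₂} det A · det [(A⁻¹)_{j_a i_b}]_{a,b}`;
  `mul_grassmannExp_quadratic_comm` (the even weight is central);
  `berezin_fourBlock_mul_grassmannExp_quadratic_eq_zero` (`#ψ̄ ≠ #ψ ⇒ 0`, word on the left);
* `norm_berezin_fourBlock_mul_grassmannExp_div_le` — over a normed field, for the weight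
  `e^{-ψ̄Dψ}` with the word on the left (an insertion `X e^{-ψ̄Dψ}`):
  `‖∫ W e^{-ψ̄Dψ} / ∫ e^{-ψ̄Dψ}‖ ≤ ‖det [(D⁻¹)_{j_a i_b}]‖` — an equality for `det D ≠ 0`, and the
  junk `x / 0 = 0 ≤ ·` otherwise (`inv_neg_of_isUnit_det`: `(-D)⁻¹ = -D⁻¹`);
* `map_relabel_gen`, `map_relabel_prod_psiBar_mul_prod_psi` — a relabelling of generators
  `θ_w ↦ θ_{τ w}` respecting `ψ̄`/`ψ` maps a two-block word to the relabelled two-block word.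

## Sources

V. Mastropietro, *Non-Perturbative Renormalization* (World Scientific, 2008), Ch. 2, §2.1–2.2:
the anticommutation rules of §2.1, (2.12) "`⟨η⁺₁ ⋯ η⁺ₚ η⁻₁ ⋯ η⁻ₚ⟩ = Det(K⁻¹)`" and the "Wick
rule" (2.24)/(2.30).  Bib key `Mastropietro2008`.
I. Montvay, G. Münster, *Quantum Fields on a Lattice* (CUP, 1994), §4.1.3, (4.25) (pair-ordered
Wick rule).  Bib key `MontvayMunster1994`.
M. Salmhofer, *Renormalization* (Springer, 1999), App. B.3, Lemma B.7 (`⟨ψ̄^I ψ^J⟩_Q = 0` for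
`|I| ≠ |J|`).  Bib key `Salmhofer1999`.
F. A. Berezin, *The Method of Second Quantization* (1966), Ch. I §3, (3.1).

## Design

No definition is introduced; the four-block word is written out as a product of four ordered
products `List.ofFn`.  Orientation and sign conventions are those of `GrassmannIntegral.lean`
(`ψ̄` before `ψ`, `+ψ̄Aψ` in the exponent); every sign drops out of the normed statement.  Not
here: general interleaved words (only the four-block shape produced by two observables), and the
expansion of observables in monomials (`GrassmannMonomialCoefficients.lean`).
-/

noncomputable section

namespace Literature.MathematicalPhysics.QuantumLattice

section QLatticeAQFT

open ExteriorAlgebra GrassmannAlgebra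

/-! ### Reordering blocks of generators -/

namespace GrassmannAlgebra

variable (R : Type*) [CommRing R] {κ : Type*} [DecidableEq κ]

/-- Moving a generator through a product of `n` generators costs `(-1)ⁿ` (Berezin 1966, (3.1);
the variant of `gen_mul_prod_map_gen` for a merely decidable index type). [folklore] -/
theorem gen_mul_prod_map_gen_of_decEq (a : κ) (l : List κ) :
    gen R a * (l.map (gen R)).prod = ((-1 : R) ^ l.length) • ((l.map (gen R)).prod * gen R a) := by
  induction l with
  | nil => simp
  | cons b l ih =>
    rw [List.map_cons, List.prod_cons, ← mul_assoc, gen_mul_gen, neg_mul, mul_assoc, ih,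
      mul_smul_comm, List.length_cons, pow_succ, mul_neg_one, neg_smul, mul_assoc]

/-- Two ordered products of `m` and `n` generators commute up to the sign `(-1)^{mn}`
(`θθ' = -θ'θ`, Berezin 1966, (3.1)). [folklore] -/
theorem prod_map_gen_mul_prod_map_gen (l₁ l₂ : List κ) :
    (l₁.map (gen R)).prod * (l₂.map (gen R)).prod =
      ((-1 : R) ^ (l₁.length * l₂.length)) • ((l₂.map (gen R)).prod * (l₁.map (gen R)).prod) := by
  induction l₁ with
  | nil => simp
  | cons a l₁ ih =>
    rw [List.map_cons, List.prod_cons, mul_assoc, ih, mul_smul_comm, ← mul_assoc,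
      gen_mul_prod_map_gen_of_decEq, smul_mul_assoc, smul_smul, List.length_cons, mul_assoc,
      ← pow_add]
    congr 2
    ring

end GrassmannAlgebra

/-- Composition with `Fin.append`, pointwise: `g (append u v t) = append (g ∘ u) (g ∘ v) t`.
[folklore] -/
theorem comp_fin_append {α β : Type*} {m n : ℕ} (g : α → β) (u : Fin m → α) (v : Fin n → α) :
    (fun t => g (Fin.append u v t)) = Fin.append (fun a => g (u a)) (fun b => g (v b)) :=
  funext (Fin.addCases (fun a => by simp) (fun b => by simp))

section Blocks

variable (R : Type*) [CommRing R] {ι : Type*} [LinearOrder ι]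

/-- A `ψ`-block moved past a `ψ̄`-block costs `(-1)^{lk}`:
`ψ_{j₁}⋯ψ_{j_l} ψ̄_{i₁}⋯ψ̄_{i_k} = (-1)^{lk} ψ̄_{i₁}⋯ψ̄_{i_k} ψ_{j₁}⋯ψ_{j_l}`. [folklore] -/
theorem prod_psi_mul_prod_psiBar {k l : ℕ} (i : Fin k → ι) (j : Fin l → ι) :
    (List.ofFn fun b => psi R (j b)).prod * (List.ofFn fun a => psiBar R (i a)).prod =
      ((-1 : R) ^ (l * k)) •
        ((List.ofFn fun a => psiBar R (i a)).prod * (List.ofFn fun b => psi R (j b)).prod) := by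
  have h := prod_map_gen_mul_prod_map_gen R (List.ofFn fun b => toLex (Sum.inr (j b)))
    (List.ofFn fun a => toLex (Sum.inl (i a)))
  simpa only [List.map_ofFn, Function.comp_def, List.length_ofFn, psi, psiBar] using h

/-- **The four-block word is a signed block word**:
`(ψ̄_{i_A} ψ_{j_A})(ψ̄_{i_B} ψ_{j_B}) = (-1)^{l₁ k₂} ψ̄_{i_A ++ i_B} ψ_{j_A ++ j_B}`
(`l₁ = |j_A|`, `k₂ = |i_B|`). [folklore] -/
theorem fourBlock_eq_smul_block {k₁ l₁ k₂ l₂ : ℕ} (iA : Fin k₁ → ι) (jA : Fin l₁ → ι)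
    (iB : Fin k₂ → ι) (jB : Fin l₂ → ι) :
    (List.ofFn fun a => psiBar R (iA a)).prod * (List.ofFn fun b => psi R (jA b)).prod *
        ((List.ofFn fun a => psiBar R (iB a)).prod * (List.ofFn fun b => psi R (jB b)).prod) =
      ((-1 : R) ^ (l₁ * k₂)) •
        ((List.ofFn fun a => psiBar R (Fin.append iA iB a)).prod *
          (List.ofFn fun b => psi R (Fin.append jA jB b)).prod) := by
  rw [comp_fin_append (psiBar R) iA iB, comp_fin_append (psi R) jA jB, List.ofFn_fin_append,
    List.ofFn_fin_append, List.prod_append, List.prod_append]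
  set PA := (List.ofFn fun a => psiBar R (iA a)).prod
  set QA := (List.ofFn fun b => psi R (jA b)).prod
  set PB := (List.ofFn fun a => psiBar R (iB a)).prod
  set QB := (List.ofFn fun b => psi R (jB b)).prod
  calc PA * QA * (PB * QB) = PA * (QA * PB) * QB := by simp only [mul_assoc]
    _ = PA * (((-1 : R) ^ (l₁ * k₂)) • (PB * QA)) * QB := by rw [prod_psi_mul_prod_psiBar]
    _ = ((-1 : R) ^ (l₁ * k₂)) • (PA * PB * (QA * QB)) := by
      simp only [mul_smul_comm, smul_mul_assoc, mul_assoc]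

variable [Fintype ι] [Algebra ℚ R]

/-- **Wick rule for four-block words** (equal numbers of `ψ̄` and `ψ`, invertible `det A`):
`∫ dψ̄dψ e^{ψ̄Aψ} (ψ̄_{i_A} ψ_{j_A})(ψ̄_{i_B} ψ_{j_B})
  = (-1)^{n(n-1)/2} (-1)^{k(k-1)/2} (-1)^{l₁k₂} det A · det [(A⁻¹)_{j_a i_b}]_{a,b}`, `k = k₁ + k₂`,
`i = i_A ++ i_B`, `j = j_A ++ j_B` (Mastropietro 2008, Ch. 2, (2.12); Montvay–Münster (4.25)).
[cite: Mastropietro2008, Ch. 2 (2.12)] -/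
theorem berezin_grassmannExp_quadratic_mul_fourBlock {k₁ l₁ k₂ l₂ : ℕ} (A : Matrix ι ι R)
    (hA : IsUnit A.det) (iA : Fin k₁ → ι) (jA : Fin l₁ → ι) (iB : Fin k₂ → ι) (jB : Fin l₂ → ι)
    (h : l₁ + l₂ = k₁ + k₂) :
    berezin R (ι ⊕ₗ ι) (grassmannExp (quadratic R A) *
        ((List.ofFn fun a => psiBar R (iA a)).prod * (List.ofFn fun b => psi R (jA b)).prod *
          ((List.ofFn fun a => psiBar R (iB a)).prod * (List.ofFn fun b => psi R (jB b)).prod))) =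
      (-1 : R) ^ (Fintype.card ι * (Fintype.card ι - 1) / 2) *
        (-1 : R) ^ ((k₁ + k₂) * (k₁ + k₂ - 1) / 2) * (-1 : R) ^ (l₁ * k₂) * A.det *
          (Matrix.of fun a b : Fin (k₁ + k₂) =>
            A⁻¹ (Fin.append jA jB (Fin.cast h.symm a)) (Fin.append iA iB b)).det := by
  rw [fourBlock_eq_smul_block, mul_smul_comm, map_smul,
    List.ofFn_congr h (fun b => psi R (Fin.append jA jB b)),
    berezin_grassmannExp_quadratic_mul_block R A hA, smul_eq_mul]
  ring

/-- The even Gaussian weight is central: `W e^{ψ̄Aψ} = e^{ψ̄Aψ} W`. [folklore] -/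
theorem mul_grassmannExp_quadratic_comm (A : Matrix ι ι R) (W : GrassmannAlgebra R (ι ⊕ₗ ι)) :
    W * grassmannExp (quadratic R A) = grassmannExp (quadratic R A) * W :=
  ((commute_of_mem_evenOdd_zero R (grassmannExp_quadratic_mem_evenOdd_zero R A) W).eq).symm

/-- **Charge selection for four-block words** (word on the left of the weight): if
`#ψ̄ ≠ #ψ` then `∫ dψ̄dψ (ψ̄_{i_A} ψ_{j_A})(ψ̄_{i_B} ψ_{j_B}) e^{ψ̄Aψ} = 0` (every `A`).
[cite: Salmhofer1999, App. B Lemma B.7] -/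
theorem berezin_fourBlock_mul_grassmannExp_quadratic_eq_zero {k₁ l₁ k₂ l₂ : ℕ} (A : Matrix ι ι R)
    (iA : Fin k₁ → ι) (jA : Fin l₁ → ι) (iB : Fin k₂ → ι) (jB : Fin l₂ → ι)
    (h : l₁ + l₂ ≠ k₁ + k₂) :
    berezin R (ι ⊕ₗ ι)
        ((List.ofFn fun a => psiBar R (iA a)).prod * (List.ofFn fun b => psi R (jA b)).prod *
            ((List.ofFn fun a => psiBar R (iB a)).prod * (List.ofFn fun b => psi R (jB b)).prod) *
          grassmannExp (quadratic R A)) = 0 := by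
  rw [mul_grassmannExp_quadratic_comm, fourBlock_eq_smul_block, mul_smul_comm, map_smul,
    berezin_grassmannExp_quadratic_mul_prod_eq_zero_of_ne R A (Ne.symm h) (Fin.append iA iB)
      (Fin.append jA jB), smul_zero]

end Blocks

/-! ### The normalised bound for the weight `e^{-ψ̄Dψ}` -/

section Normed

open GrassmannAlgebra

variable {K : Type*} [NormedField K] [Algebra ℚ K] {ι : Type*} [LinearOrder ι] [Fintype ι]

/-- For invertible `det D`, `(-D)⁻¹ = -D⁻¹`. [folklore] -/
theorem inv_neg_of_isUnit_det {n : Type*} [Fintype n] [DecidableEq n] {S : Type*} [CommRing S]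
    (D : Matrix n n S) (hD : IsUnit D.det) : (-D)⁻¹ = -D⁻¹ :=
  Matrix.inv_eq_left_inv (by rw [neg_mul_neg, Matrix.nonsing_inv_mul D hD])

/-- **Wick bound for four-block words, normalised form** for the weight `e^{-ψ̄Dψ}` (word on the
left, as for an insertion `X e^{-ψ̄Dψ}`): when `#ψ̄ = #ψ = k`,
`‖∫ (ψ̄_{i_A} ψ_{j_A})(ψ̄_{i_B} ψ_{j_B}) e^{-ψ̄Dψ} / ∫ e^{-ψ̄Dψ}‖ ≤ ‖det [(D⁻¹)_{j_a i_b}]_{a,b}‖`,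
`i = i_A ++ i_B`, `j = j_A ++ j_B` — an equality for `det D ≠ 0` (all signs have norm one), and
`0 ≤ ·` for `det D = 0`, where the left side is the junk value `x / 0 = 0`
(Mastropietro 2008, Ch. 2, (2.12), (2.30); Montvay–Münster (4.25)).
[cite: Mastropietro2008, Ch. 2 (2.30)] -/
theorem norm_berezin_fourBlock_mul_grassmannExp_div_le {k₁ l₁ k₂ l₂ : ℕ} (D : Matrix ι ι K)
    (iA : Fin k₁ → ι) (jA : Fin l₁ → ι) (iB : Fin k₂ → ι) (jB : Fin l₂ → ι)
    (h : l₁ + l₂ = k₁ + k₂) :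
    ‖berezin K (ι ⊕ₗ ι)
          ((List.ofFn fun a => psiBar K (iA a)).prod * (List.ofFn fun b => psi K (jA b)).prod *
              ((List.ofFn fun a => psiBar K (iB a)).prod * (List.ofFn fun b => psi K (jB b)).prod) *
            grassmannExp (quadratic K (-D))) /
        berezin K (ι ⊕ₗ ι) (grassmannExp (quadratic K (-D)))‖ ≤
      ‖(Matrix.of fun a b : Fin (k₁ + k₂) =>
          D⁻¹ (Fin.append jA jB (Fin.cast h.symm a)) (Fin.append iA iB b)).det‖ := by
  have hZ : berezin K (ι ⊕ₗ ι) (grassmannExp (quadratic K (-D))) =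
      (-1 : K) ^ (Fintype.card ι * (Fintype.card ι - 1) / 2) * (-D).det :=
    berezin_grassmannExp_quadratic_holds K (-D)
  by_cases hD : D.det = 0
  · rw [hZ, Matrix.det_neg, hD, mul_zero, mul_zero, div_zero, norm_zero]
    exact norm_nonneg _
  have hD' : IsUnit (-D).det := by
    rw [Matrix.det_neg]
    exact Ne.isUnit (mul_ne_zero (pow_ne_zero _ (neg_ne_zero.2 one_ne_zero)) hD)
  have hM : (Matrix.of fun a b : Fin (k₁ + k₂) =>
      (-D⁻¹) (Fin.append jA jB (Fin.cast h.symm a)) (Fin.append iA iB b)) =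
      -(Matrix.of fun a b : Fin (k₁ + k₂) =>
        D⁻¹ (Fin.append jA jB (Fin.cast h.symm a)) (Fin.append iA iB b)) := by
    ext a b
    rfl
  rw [mul_grassmannExp_quadratic_comm, berezin_grassmannExp_quadratic_mul_fourBlock K (-D) hD'
    iA jA iB jB h, hZ, inv_neg_of_isUnit_det D (Ne.isUnit hD), hM,
    Matrix.det_neg (Matrix.of fun a b : Fin (k₁ + k₂) =>
      D⁻¹ (Fin.append jA jB (Fin.cast h.symm a)) (Fin.append iA iB b))]
  simp only [norm_div, norm_mul, norm_pow, norm_neg, norm_one, one_pow, one_mul]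
  rw [mul_div_cancel_left₀ _ (norm_ne_zero_iff.2 hD'.ne_zero)]

end Normed

/-! ### Relabelling generators -/

section Relabel

open GrassmannAlgebra

variable (R : Type*) [CommRing R] {κ κ' : Type*} [Fintype κ] [DecidableEq κ] [DecidableEq κ']

/-- The relabelling `θ_w ↦ θ_{τ w}` (the algebra map induced by `e_w ↦ e_{τ w}` on generator
coefficients) on a generator. [folklore] -/
theorem map_relabel_gen (τ : κ → κ') (w : κ) :
    ExteriorAlgebra.map (Fintype.linearCombination R fun w => Pi.single (τ w) (1 : R)) (gen R w) =
      gen R (τ w) := by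
  rw [gen, ExteriorAlgebra.map_apply_ι, Fintype.linearCombination_apply_single, one_smul, gen]

variable {ι ι' : Type*} [Fintype ι] [DecidableEq ι] [DecidableEq ι']

/-- A relabelling of complex-fermion generators respecting `ψ̄`/`ψ` maps a two-block word to the
relabelled two-block word. [folklore] -/
theorem map_relabel_prod_psiBar_mul_prod_psi (τ : ι ⊕ₗ ι → ι' ⊕ₗ ι') (g g' : ι → ι')
    (hl : ∀ x, τ (toLex (Sum.inl x)) = toLex (Sum.inl (g x)))
    (hr : ∀ x, τ (toLex (Sum.inr x)) = toLex (Sum.inr (g' x))) {k l : ℕ} (i : Fin k → ι)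
    (j : Fin l → ι) :
    ExteriorAlgebra.map (Fintype.linearCombination R fun w => Pi.single (τ w) (1 : R))
        ((List.ofFn fun a => psiBar R (i a)).prod * (List.ofFn fun b => psi R (j b)).prod) =
      (List.ofFn fun a => psiBar R (g (i a))).prod *
        (List.ofFn fun b => psi R (g' (j b))).prod := by
  rw [map_mul, map_list_prod, map_list_prod, List.map_ofFn, List.map_ofFn]
  simp only [Function.comp_def, psiBar, psi, map_relabel_gen, hl, hr]

end Relabel

end QLatticeAQFT

end Literature.MathematicalPhysics.QuantumLattice
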